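import Summits.AtomisticToContinuum.HydrodynamicLimit.Theorems.CollisionIsometryCLTCollisionalTransferLocalityDefs
import Literature.MathematicalPhysics.KineticTheory.HardSphereUniformGas
import HarnessLib

/-!
# Moments of velocity empirical averages under the homogeneous local Gibbs law

Helper file (`--supports stmt-AtomisticToContinuum-9518`, line `hemisphere-affine-slaving`, skeleton
v10.1) for the crux `CollisionalTransferLocality`: the three registered stubs of the equilibrium rung
on velocity empirical averages `z ↦ (N+1)⁻¹ Σᵢ g(vᵢ)` of `N + 1` hard spheres of reduced diameter
`hsDiameter σ N` on `𝕋³` under the homogeneous ("rung 0") local Gibbs law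
`G_N = localGibbsLaw σ (fun _ => a) (fun _ => u) (fun _ => θ) N (Φ N)` (constant activity `a > 0`,
velocity `u`, temperature `θ > 0`, `σ ≤ 1/2`, any flow `Φ N`):

* `integral_velAvg_localGibbsLaw_const` : `∫ (N+1)⁻¹ Σᵢ g(vᵢ) dG_N = ∫ g dγ` for `g ∈ L¹(γ)`;
* `integral_velAvg_sq_le_localGibbsLaw_const` : `∫ ((N+1)⁻¹ Σᵢ g(vᵢ))² dG_N ≤ ∫ g² dγ` for
  `g ∈ L²(γ)`;
* `memLp_two_velAvg_localGibbsLaw_const` : `z ↦ (N+1)⁻¹ Σᵢ g(vᵢ) ∈ L²(G_N)` for `g ∈ L²(γ)`,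

where `γ = gaussMeasure u θ` is the isotropic Gaussian `N(u, θ id)` on `V3 = ℝ³`.

Proofs. By the rung-0 product structure (`localGibbsLaw_eq`, `localGibbsMeasure_rung0_eq_map`)
`G_N = zipConfig_# (posGibbsMeasure ⊗ γ^{⊗(N+1)})`, and for `σ ≤ 1/2` the configurational factor is a
probability measure (`isProbabilityMeasure_posGibbsMeasure`); hence each velocity coordinate
`z ↦ vᵢ` pushes `G_N` forward to `γ` (`measurePreserving_vel_localGibbsLaw_const`: `Measure.map_map`,
`measurePreserving_snd`, `measurePreserving_eval`). Everything else is bookkeeping along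
measure-preserving maps: integrals (`integral_map`), integrability
(`MeasurePreserving.integrable_comp_of_integrable`), square integrability
(`MemLp.comp_measurePreserving`, `memLp_finsetSum`, `MemLp.const_mul`), and for the second moment the
finite Cauchy–Schwarz / Jensen inequality `((N+1)⁻¹ Σᵢ wᵢ)² ≤ (N+1)⁻¹ Σᵢ wᵢ²`
(`sq_sum_le_card_mul_sum_sq`) integrated against `G_N` (`integral_mono_of_nonneg`) followed by the
first identity for `g²` (`MemLp.integrable_sq`). Folklore; nothing is cited and no dynamics enters
(Spohn 1991, Part I §2.3, local equilibrium states, is the background for the product structure,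
already recorded on the imported tools).
-/

namespace Summit.AtomisticToContinuum.HydrodynamicLimit.Theorems.HemisphereAffineSlaving

open scoped BigOperators Topology Classical ENNReal InnerProductSpace
open Filter Set Function MeasureTheory

noncomputable section

open Literature.MathematicalPhysics.KineticTheory (T3 V3)
open Literature.MathematicalPhysics.KineticTheory (gaussMeasure localGibbsLaw localGibbsLaw_eq
  localGibbsMeasure_rung0_eq_map posGibbsMeasure hsDiameter zipConfig measurable_zipConfig
  isProbabilityMeasure_posGibbsMeasure)

/-! ### The law of one velocity under the homogeneous local Gibbs law -/

/-- A coordinate of the second factor of `P ⊗ γ^{⊗ι}` has law `γ` when `P` and `γ` are probability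
measures (`measurePreserving_snd`, `measurePreserving_eval`). [folklore] -/
theorem measurePreserving_snd_eval {α X ι : Type*} [MeasurableSpace α] [MeasurableSpace X]
    [Fintype ι] (P : Measure α) [IsProbabilityMeasure P] (γ : Measure X) [IsProbabilityMeasure γ]
    (i : ι) :
    MeasurePreserving (fun p : α × (ι → X) => p.2 i) (P.prod (Measure.pi fun _ : ι => γ)) γ :=
  (measurePreserving_eval (fun _ : ι => γ) i).comp measurePreserving_snd

/-- A finite average squared is at most the average of the squares:
`((N+1)⁻¹ Σᵢ wᵢ)² ≤ (N+1)⁻¹ Σᵢ wᵢ²` (Cauchy–Schwarz, `sq_sum_le_card_mul_sum_sq`). [folklore] -/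
theorem sq_velAvg_le_velAvg_sq {N : ℕ} (w : Fin (N + 1) → ℝ) :
    (((N : ℝ) + 1)⁻¹ * ∑ i, w i) ^ 2 ≤ ((N : ℝ) + 1)⁻¹ * ∑ i, w i ^ 2 := by
  have hn : (0 : ℝ) < (N : ℝ) + 1 := by positivity
  have h := sq_sum_le_card_mul_sum_sq (s := (Finset.univ : Finset (Fin (N + 1)))) (f := w)
  rw [Finset.card_univ, Fintype.card_fin, Nat.cast_add, Nat.cast_one] at h
  rw [mul_pow]
  calc ((N : ℝ) + 1)⁻¹ ^ 2 * (∑ i, w i) ^ 2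
      ≤ ((N : ℝ) + 1)⁻¹ ^ 2 * (((N : ℝ) + 1) * ∑ i, w i ^ 2) :=
        mul_le_mul_of_nonneg_left h (sq_nonneg _)
    _ = ((N : ℝ) + 1)⁻¹ * ∑ i, w i ^ 2 := by
        field_simp

/-- **Each velocity is `N(u, θ id)`-distributed under the homogeneous local Gibbs law**: for constant
profiles `a > 0`, `θ > 0`, `u`, reduced density `σ ≤ 1/2`, every flow and every label `i`, the map
`z ↦ vᵢ` pushes `localGibbsLaw σ a u θ N (Φ N)` forward to `gaussMeasure u θ` (rung-0 product
structure `localGibbsMeasure_rung0_eq_map`, the configurational factor being a probability measure,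
`isProbabilityMeasure_posGibbsMeasure`). [folklore] -/
theorem measurePreserving_vel_localGibbsLaw_const {σ a θ : ℝ} (ha : 0 < a) (hθ : 0 < θ)
    (hσ : σ ≤ 1 / 2) (u : V3) (Φ : Flows σ) (N : ℕ) (i : Fin (N + 1)) :
    MeasurePreserving (fun z : Cfg N => (z i).2)
      (localGibbsLaw σ (fun _ => a) (fun _ => u) (fun _ => θ) N (Φ N)) (gaussMeasure u θ) := by
  haveI := isProbabilityMeasure_posGibbsMeasure (a₀ := fun _ : T3 => a) continuous_const
    (fun _ => ha) hσ N
  refine ⟨(measurable_pi_apply i).snd, ?_⟩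
  rw [localGibbsLaw_eq, localGibbsMeasure_rung0_eq_map σ ha.le hθ u N,
    Measure.map_map (measurable_pi_apply i).snd measurable_zipConfig]
  exact (measurePreserving_snd_eval _ (gaussMeasure u θ) i).map_eq

/-- Integrals of a function of one velocity under the homogeneous local Gibbs law are its Gaussian
integrals: `∫ g(vᵢ) dG_N = ∫ g dγ` for `g ∈ L¹(γ)`. [folklore] -/
theorem integral_vel_localGibbsLaw_const {σ a θ : ℝ} (ha : 0 < a) (hθ : 0 < θ) (hσ : σ ≤ 1 / 2)
    (u : V3) (Φ : Flows σ) (N : ℕ) (i : Fin (N + 1)) {g : V3 → ℝ}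
    (hg : Integrable g (gaussMeasure u θ)) :
    ∫ z, g (z i).2 ∂(localGibbsLaw σ (fun _ => a) (fun _ => u) (fun _ => θ) N (Φ N)) =
      ∫ v, g v ∂(gaussMeasure u θ) := by
  have hψ := measurePreserving_vel_localGibbsLaw_const ha hθ hσ u Φ N i
  have hgm : AEStronglyMeasurable g
      (Measure.map (fun z : Cfg N => (z i).2)
        (localGibbsLaw σ (fun _ => a) (fun _ => u) (fun _ => θ) N (Φ N))) := by
    rw [hψ.map_eq]; exact hg.aestronglyMeasurable
  have h := integral_map hψ.measurable.aemeasurable hgm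
  rw [hψ.map_eq] at h
  exact h.symm

/-! ### The three registered stubs -/

/-- **Mean of a velocity empirical average** under the homogeneous local Gibbs law:
`∫ (N+1)⁻¹ Σᵢ g(vᵢ) dG_N = ∫ g dγ` for `g ∈ L¹(γ)`, `γ = N(u, θ id)` (each `vᵢ` has law `γ`).
[folklore] -/
theorem integral_velAvg_localGibbsLaw_const : ∀ {σ a θ : ℝ}, 0 < a → 0 < θ → σ ≤ 1 / 2 → ∀ (u : V3) (Φ : Flows σ) (N : ℕ) (g : V3 → ℝ), Integrable g (Literature.MathematicalPhysics.KineticTheory.gaussMeasure u θ) → ∫ z, ((N : ℝ) + 1)⁻¹ * ∑ i : Fin (N + 1), g (z i).2 ∂(Literature.MathematicalPhysics.KineticTheory.localGibbsLaw σ (fun _ => a) (fun _ => u) (fun _ => θ) N (Φ N)) = ∫ v, g v ∂(Literature.MathematicalPhysics.KineticTheory.gaussMeasure u θ) := by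
  intro σ a θ ha hθ hσ u Φ N g hg
  have hn : ((N : ℝ) + 1) ≠ 0 := by positivity
  have hint : ∀ i : Fin (N + 1), Integrable (fun z : Cfg N => g (z i).2)
      (localGibbsLaw σ (fun _ => a) (fun _ => u) (fun _ => θ) N (Φ N)) := fun i =>
    (measurePreserving_vel_localGibbsLaw_const ha hθ hσ u Φ N i).integrable_comp_of_integrable hg
  rw [integral_const_mul, integral_finsetSum _ fun i _ => hint i]
  simp_rw [integral_vel_localGibbsLaw_const ha hθ hσ u Φ N _ hg]
  rw [Finset.sum_const, Finset.card_univ, Fintype.card_fin, nsmul_eq_mul, Nat.cast_add,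
    Nat.cast_one, ← mul_assoc, inv_mul_cancel₀ hn, one_mul]

/-- **Second moment of a velocity empirical average** under the homogeneous local Gibbs law:
`∫ ((N+1)⁻¹ Σᵢ g(vᵢ))² dG_N ≤ ∫ g² dγ` for `g ∈ L²(γ)` (finite Cauchy–Schwarz pointwise, then the
mean of the empirical average of `g²`). [folklore] -/
theorem integral_velAvg_sq_le_localGibbsLaw_const : ∀ {σ a θ : ℝ}, 0 < a → 0 < θ → σ ≤ 1 / 2 → ∀ (u : V3) (Φ : Flows σ) (N : ℕ) (g : V3 → ℝ), MemLp g 2 (Literature.MathematicalPhysics.KineticTheory.gaussMeasure u θ) → ∫ z, (((N : ℝ) + 1)⁻¹ * ∑ i : Fin (N + 1), g (z i).2) ^ 2 ∂(Literature.MathematicalPhysics.KineticTheory.localGibbsLaw σ (fun _ => a) (fun _ => u) (fun _ => θ) N (Φ N)) ≤ ∫ v, g v ^ 2 ∂(Literature.MathematicalPhysics.KineticTheory.gaussMeasure u θ) := by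
  intro σ a θ ha hθ hσ u Φ N g hg
  have h2 : Integrable (fun v => g v ^ 2) (gaussMeasure u θ) := hg.integrable_sq
  have hup : Integrable (fun z : Cfg N => ((N : ℝ) + 1)⁻¹ * ∑ i : Fin (N + 1), g (z i).2 ^ 2)
      (localGibbsLaw σ (fun _ => a) (fun _ => u) (fun _ => θ) N (Φ N)) :=
    (integrable_finsetSum (f := fun (i : Fin (N + 1)) (z : Cfg N) => g (z i).2 ^ 2) _ fun i _ =>
      (measurePreserving_vel_localGibbsLaw_const ha hθ hσ u Φ N i).integrable_comp_of_integrable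
        h2).const_mul _
  calc ∫ z, (((N : ℝ) + 1)⁻¹ * ∑ i : Fin (N + 1), g (z i).2) ^ 2
        ∂(localGibbsLaw σ (fun _ => a) (fun _ => u) (fun _ => θ) N (Φ N))
      ≤ ∫ z, ((N : ℝ) + 1)⁻¹ * ∑ i : Fin (N + 1), g (z i).2 ^ 2
          ∂(localGibbsLaw σ (fun _ => a) (fun _ => u) (fun _ => θ) N (Φ N)) :=
        integral_mono_of_nonneg (ae_of_all _ fun z => sq_nonneg _) hup
          (ae_of_all _ fun z => sq_velAvg_le_velAvg_sq fun i => g (z i).2)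
    _ = ∫ v, g v ^ 2 ∂(gaussMeasure u θ) :=
        integral_velAvg_localGibbsLaw_const ha hθ hσ u Φ N (fun v => g v ^ 2) h2

/-- **Velocity empirical averages are square integrable** under the homogeneous local Gibbs law:
`z ↦ (N+1)⁻¹ Σᵢ g(vᵢ) ∈ L²(G_N)` for `g ∈ L²(γ)` (each summand is `g` composed with a
measure-preserving map). [folklore] -/
theorem memLp_two_velAvg_localGibbsLaw_const : ∀ {σ a θ : ℝ}, 0 < a → 0 < θ → σ ≤ 1 / 2 → ∀ (u : V3) (Φ : Flows σ) (N : ℕ) (g : V3 → ℝ), MemLp g 2 (Literature.MathematicalPhysics.KineticTheory.gaussMeasure u θ) → MemLp (fun z : Cfg N => ((N : ℝ) + 1)⁻¹ * ∑ i : Fin (N + 1), g (z i).2) 2 (Literature.MathematicalPhysics.KineticTheory.localGibbsLaw σ (fun _ => a) (fun _ => u) (fun _ => θ) N (Φ N)) := by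
  intro σ a θ ha hθ hσ u Φ N g hg
  exact (memLp_finsetSum (f := fun (i : Fin (N + 1)) (z : Cfg N) => g (z i).2) Finset.univ
    fun i _ => hg.comp_measurePreserving
      (measurePreserving_vel_localGibbsLaw_const ha hθ hσ u Φ N i)).const_mul _

end

end Summit.AtomisticToContinuum.HydrodynamicLimit.Theorems.HemisphereAffineSlaving
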